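import Literature.AlgebraicGeometry.HodgeTheory.UniversalHypersurfaceDiscriminant
import Literature.AlgebraicGeometry.Motives.MonomialSupportedHypersurfaceSymmetry
import Literature.AlgebraicGeometry.Motives.GeneralNonsingularForms
import Literature.Algebra.Polynomial.JacobianCriterion
import HarnessLib

/-!
# K1-B meridian package, G2 part (a): the diagonal action on coefficient vectors preserves the discriminant
# (route `SignSymmetricPowers`, item stmt-HodgeConjecture-19716; helper for GEN / LINK-G)

Helper file (`--supports stmt-HodgeConjecture-19716`).  For a diagonal `γ : Fin (n+2) → ℂˣ` acting on forms by
`σ_γ F = F(γ₀x₀, …)` (`aeval (diagSubstK ℂ n γ)`, `Motives/UniversalHypersurfaceTorusAction`), the induced action on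
coefficient vectors `a : DegIndex n d → ℂ` is the coordinatewise scaling by the weights `γ^m`
(`w_γ * a`, `w_γ m = unitWeight ℂ n γ m`):

* `formOfCoeffs_weight_mul` — `formOfCoeffs (w_γ * a) = σ_γ (formOfCoeffs a)`;
* `pderiv_aeval_diagSubstK`, `eval_aeval_diagSubstK` — chain rule and evaluation for `σ_γ`;
* `isNonsingularForm_aeval_diagSubstK_iff` — `σ_γ F` is nonsingular iff `F` is (points criterion, `ℂ` alg. closed);
* `weight_mul_mem_singularCoeffs_iff` — **`singularCoeffs` is stable under the diagonal action**;
* `evalCoeffCLM_weight_mul` — `ev_x (w_γ * a) = ev_{γ • x} (a)` (how the tangent hyperplanes of F-DISC-1 move);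
* `weight_mul_extend_eq` — on the `M`-supported coefficient vectors (`M` fixed by `γ`, `FixesMonomials`) the action is
  trivial.
These feed the pair-centre analysis (`SignSymmetricPowersGenPairCentre`): at a form with an exchanged pair of nodes
`q, γq` the two local branches of the discriminant are swapped by the action and coincide on `A_M`.

Sorry-free; axioms standard; no definition, no named fact.

## References

* [VoisinHodgeII2003] C. Voisin, Hodge Theory and Complex Algebraic Geometry II (CUP 2003), §2.1.1.
* [Katz2009] N. M. Katz, Another look at the Dwork family (2009), §3 (the diagonal torus action).
-/

noncomputable section

set_option linter.dupNamespace false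

open MvPolynomial
open Literature.AlgebraicGeometry.Motives Literature.AlgebraicGeometry.Motives.UniversalHypersurface
open Literature.AlgebraicGeometry.HodgeTheory

namespace Summit.HodgeConjecture.HodgeConjecture.Theorems.SignSymmetricPowersGenDiagonalCoeff

variable {n d : ℕ} (γ : Fin (n + 2) → ℂˣ)

/-! ### §1 The diagonal substitution on forms: evaluation, chain rule, nonsingularity -/

/-- `(σ_γ F)(z) = F(γ • z)` with `(γ • z)ᵢ = γᵢ zᵢ`. [cite: Katz2009, §3] -/
theorem eval_aeval_diagSubstK (F : MvPolynomial (Fin (n + 2)) ℂ) (z : Fin (n + 2) → ℂ) :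
    eval z (aeval (diagSubstK ℂ n γ) F) = eval (fun i => (γ i : ℂ) * z i) F := by
  have h1 : eval z (aeval (diagSubstK ℂ n γ) F) = ((aeval z).comp (aeval (diagSubstK ℂ n γ))) F := by
    rw [AlgHom.comp_apply]
    exact (DFunLike.congr_fun (coe_aeval_eq_eval z) _).symm
  have h2 : (fun i => aeval z (diagSubstK ℂ n γ i)) = fun i => (γ i : ℂ) * z i := by
    funext i
    simp [diagSubstK]
  rw [h1, comp_aeval, h2]
  exact DFunLike.congr_fun (coe_aeval_eq_eval _) F

/-- **Chain rule for the diagonal substitution**: `∂ⱼ(σ_γ F) = γⱼ · σ_γ(∂ⱼ F)`. [cite: Katz2009, §3] -/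
theorem pderiv_aeval_diagSubstK (F : MvPolynomial (Fin (n + 2)) ℂ) (j : Fin (n + 2)) :
    pderiv j (aeval (diagSubstK ℂ n γ) F) = C (γ j : ℂ) * aeval (diagSubstK ℂ n γ) (pderiv j F) := by
  classical
  rw [Literature.Algebra.Polynomial.JacobianCriterion.pderiv_aeval]
  have hδ : ∀ i, pderiv j (diagSubstK ℂ n γ i) = if i = j then C (γ j : ℂ) else 0 := by
    intro i
    simp only [diagSubstK, Derivation.leibniz, pderiv_C, smul_zero, add_zero, pderiv_X, Pi.single_apply]
    split_ifs with h
    · subst h; simp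
    · simp
  simp_rw [hδ]
  simp [Finset.sum_ite_eq', mul_comm]

/-- **`σ_γ F` is a nonsingular form iff `F` is** (`γ` invertible; points criterion over the algebraically closed
field `ℂ`). [cite: Hartshorne1977, I Ex. 5.8] -/
theorem isNonsingularForm_aeval_diagSubstK_iff (F : MvPolynomial (Fin (n + 2)) ℂ) :
    SmoothHypersurface.IsNonsingularForm ℂ (aeval (diagSubstK ℂ n γ) F) ↔
      SmoothHypersurface.IsNonsingularForm ℂ F := by
  rw [SmoothHypersurface.isNonsingularForm_iff_forall_exists_eval_pderiv_ne_zero,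
    SmoothHypersurface.isNonsingularForm_iff_forall_exists_eval_pderiv_ne_zero]
  constructor
  · intro h z hz hFz
    -- apply `h` at `γ⁻¹ • z`
    have hz' : (fun i => ((γ i)⁻¹ : ℂˣ) * z i : Fin (n + 2) → ℂ) ≠ 0 := by
      intro h0; apply hz; funext i
      have := congr_fun h0 i
      simpa using this
    have hscale : (fun i => (γ i : ℂ) * (((γ i)⁻¹ : ℂˣ) * z i : ℂ)) = z := by
      funext i; rw [← mul_assoc, Units.mul_inv, one_mul]
    obtain ⟨j, hj⟩ := h _ hz' (by rw [eval_aeval_diagSubstK, hscale]; exact hFz)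
    refine ⟨j, ?_⟩
    rw [pderiv_aeval_diagSubstK, map_mul, eval_C, eval_aeval_diagSubstK, hscale] at hj
    exact right_ne_zero_of_mul hj
  · intro h z hz hFz
    have hz' : (fun i => (γ i : ℂ) * z i : Fin (n + 2) → ℂ) ≠ 0 := by
      intro h0; apply hz; funext i
      have := congr_fun h0 i
      simpa using this
    rw [eval_aeval_diagSubstK] at hFz
    obtain ⟨j, hj⟩ := h _ hz' hFz
    refine ⟨j, ?_⟩
    rw [pderiv_aeval_diagSubstK, map_mul, eval_C, eval_aeval_diagSubstK]
    exact mul_ne_zero (Units.ne_zero _) hj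

/-! ### §2 The action on coefficient vectors -/

/-- **The diagonal action on coefficient vectors is the weight scaling**: the form of `(γ^m a_m)_m` is `σ_γ` of
the form of `a`. [cite: Katz2009, §3] -/
theorem formOfCoeffs_weight_mul (a : DegIndex n d → ℂ) :
    formOfCoeffs ((fun m : DegIndex n d => (unitWeight ℂ n γ m.1 : ℂ)) * a) =
      aeval (diagSubstK ℂ n γ) (formOfCoeffs a) := by
  rw [formOfCoeffs_def, formOfCoeffs_def, map_sum]
  refine Finset.sum_congr rfl fun m _ => ?_
  rw [aeval_diagSubstK_monomial, Pi.mul_apply]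

/-- **`singularCoeffs` is stable under the diagonal action.** [cite: EisenbudHarris2016, §7.1 Prop. 7.1] -/
theorem weight_mul_mem_singularCoeffs_iff (a : DegIndex n d → ℂ) :
    (fun m : DegIndex n d => (unitWeight ℂ n γ m.1 : ℂ)) * a ∈ singularCoeffs n d ↔ a ∈ singularCoeffs n d := by
  rw [mem_singularCoeffs_iff, mem_singularCoeffs_iff, formOfCoeffs_weight_mul, isNonsingularForm_aeval_diagSubstK_iff]

/-- **The evaluation functionals move by `γ`**: `ev_x (γ ⋆ a) = ev_{γ • x} (a)`. [cite: VoisinHodgeII2003, §2.1.1 Cor. 2.8] -/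
theorem evalCoeffCLM_weight_mul (x : Fin (n + 2) → ℂ) (a : DegIndex n d → ℂ) :
    evalCoeffCLM n d x ((fun m : DegIndex n d => (unitWeight ℂ n γ m.1 : ℂ)) * a) =
      evalCoeffCLM n d (fun i => (γ i : ℂ) * x i) a := by
  rw [evalCoeffCLM_apply, evalCoeffCLM_apply, formOfCoeffs_weight_mul, eval_aeval_diagSubstK]

/-- The weight scaling as a continuous linear map of `ℂ^{DegIndex n d}`. [folklore] -/
theorem weightCLM_apply (a : DegIndex n d → ℂ) :
    (ContinuousLinearMap.pi fun m : DegIndex n d =>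
        (unitWeight ℂ n γ m.1 : ℂ) • ContinuousLinearMap.proj (R := ℂ) (φ := fun _ : DegIndex n d => ℂ) m) a =
      (fun m : DegIndex n d => (unitWeight ℂ n γ m.1 : ℂ)) * a := by
  funext m
  simp [Pi.mul_apply]

/-! ### §3 On `M`-supported coefficient vectors the action is trivial -/

variable (n d) (M : Set (DegIndex n d)) [DecidablePred (· ∈ M)]

/-- **If `γ` fixes the monomials of `M`, the weight scaling fixes the extension by zero of every `a : M → ℂ`.**
[cite: Katz2009, §3] -/
theorem weight_mul_extend_eq {γ : Fin (n + 2) → ℂˣ} (hγ : FixesMonomials ℂ n d M γ) (a : M → ℂ) :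
    (fun m : DegIndex n d => (unitWeight ℂ n γ m.1 : ℂ)) *
        (fun m : DegIndex n d => if h : m ∈ M then a ⟨m, h⟩ else 0) =
      fun m : DegIndex n d => if h : m ∈ M then a ⟨m, h⟩ else 0 := by
  funext m
  by_cases hm : m ∈ M
  · simp only [Pi.mul_apply, dif_pos hm, hγ m hm, Units.val_one, one_mul]
  · simp only [Pi.mul_apply, dif_neg hm, mul_zero]

/-- An `M`-supported point lies in `singularCoeffs` iff its image under the action does (trivially, the action fixes
it) — recorded in the form used by the pair-centre analysis: for `z` near an `M`-point, `γ ⋆ z` is singular iff `z`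
is. [cite: EisenbudHarris2016, §7.1 Prop. 7.1] -/
theorem mem_singularCoeffs_weight_mul_iff' (γ : Fin (n + 2) → ℂˣ) (z : DegIndex n d → ℂ) :
    z ∈ singularCoeffs n d ↔ (fun m : DegIndex n d => (unitWeight ℂ n γ m.1 : ℂ)) * z ∈ singularCoeffs n d :=
  (weight_mul_mem_singularCoeffs_iff γ z).symm

end Summit.HodgeConjecture.HodgeConjecture.Theorems.SignSymmetricPowersGenDiagonalCoeff

end
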